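import Summits.RiemannHypothesis.RiemannHypothesis.Theorems.UniversalFactorMediumHighCover

/-!
# RiemannHypothesis / UniversalFactor — `MediumKernelNoGo`, high window 1: the compiled certificate

Route `RiemannHypothesis/UniversalFactor`, crux `MediumKernelNoGo` (stmt-RiemannHypothesis-2577), line
`one-sided-average-sign-test`, stub `stub_highWindow`.  The window check `hiRun 10 46 38 As 1000`
(cells of half-width 1/10, 46 backward and 38 forward cells at `t₀ = 7005.08`, boxes
`As/1000 = [1500, 2000, 2500, 3100, 4000]`) is evaluated ONCE by `native_decide` (a certified computation: the certified `ζ`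
evaluator at the 1344 Gauss–Legendre nodes, then interval re-weighting per box), and
`hiRunWith_sound` turns it into the dip certificate `H_0(x₀) < 0 < P_a(x₀), Q_a(x₀)`, `x₀ = 2t₀`, for every
`a ∈ [3 / 2, 4]`.
-/

set_option linter.dupNamespace false

namespace Summit.RiemannHypothesis.RiemannHypothesis.Theorems

open Set MeasureTheory
open Literature.NumberTheory.LFunctions Literature.NumberTheory.LFunctions.ZetaNumerics

/-- The breakpoints of window 1 (over `1000`). [folklore] -/
def UniversalFactor.hiAs1 : List ℕ := [1500, 2000, 2500, 3100, 4000]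

/-- **The compiled check of window 1.** [folklore] -/
theorem UniversalFactor.hiWin1_check : UniversalFactor.hiRun 10 46 38 UniversalFactor.hiAs1 1000 = true := by
  native_decide

/-- **Window 1 of `stub_highWindow`**: the dip certificate at `x₀ = 2t₀` for `3 / 2 ≤ a ≤ 4`. [folklore] -/
theorem UniversalFactor.stub_highWindow1 : ∀ a : ℝ, (3 : ℝ) / 2 ≤ a → a ≤ 4 →
    (deBruijnH 0 ((2 * UniversalFactor.lehmerT0 : ℝ) : ℂ)).re < 0 ∧
      0 < (∫ y in Ioi (0:ℝ), deBruijnH 0 (((2 * UniversalFactor.lehmerT0 : ℝ) : ℂ) - y) * (Real.exp (-(a * y)) : ℂ)).re ∧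
      0 < (∫ y in Ioi (0:ℝ), deBruijnH 0 (((2 * UniversalFactor.lehmerT0 : ℝ) : ℂ) + y) * (Real.exp (-(a * y)) : ℂ)).re :=
  fun a h1 h2 =>
    UniversalFactor.hiRunWith_sound (oT := UniversalFactor.lehmerTables)
      (fun T hT => by unfold UniversalFactor.lehmerTables at hT; exact mkTables_valid hT)
      UniversalFactor.hiWin1_check
      (by simp only [UniversalFactor.hiAs1, List.getD_cons_zero]; push_cast; linarith)
      (by simp only [UniversalFactor.hiAs1, List.length_cons, List.length_nil, List.getD_cons_succ, List.getD_cons_zero]; push_cast; linarith)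

end Summit.RiemannHypothesis.RiemannHypothesis.Theorems
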